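import Summits.Ventures.CertifiedManyBodySolver.Certificates.HubbardSquare_cellword_KitImg
import Literature.MathematicalPhysics.QuantumLattice.HubbardTTPrimeDiagHopTransport
import HarnessLib

/-!
# Ventures/CertifiedManyBodySolver — Certificates/HubbardSquare_cellword_KitImgEdge.lean (hubbard-box-eng-2 g5, cell hubbard-fast)

HONEST FRAMING: transport bookkeeping of certified ground-state-energy bounds; not a superconductivity verdict; no number of
record is certified here — ONE generic composition lemma for the POINTWISE census-cell words on a `t′`-EDGE strip (a material
box reaching `δ` beyond the last certified `t′`-column, e.g. the NCCO T′-column M55 image at `t′ = 0.499 < 1/2`): a floor `X` at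
the column `t′ = s` is carried to `t′ = s'` at the kinematic price `(16/π²)·|s' − s| ≤ 1.621139·|s' − s|`
(`energyDensityTT'_sub_sixteen_div_pi_sq_mul_le`: the next-nearest-neighbour kinetic density of any state is at most `16/π²`
in absolute value per unit `t′`). The constant `1621139/10⁶` is the outward decimal used by `HubbardSquare_cellword_KitEdge`.
-/

noncomputable section

namespace Summit.Ventures.CertifiedManyBodySolver.Certificates

open Matrix Finset Filter Topology
open Literature.MathematicalPhysics.QuantumLattice
open Literature.MathematicalPhysics.QuantumLattice.ThermodynamicLimit
open Literature.Probability.LatticeModels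
open scoped ComplexOrder ComplexConjugate Topology BigOperators

/-- `16/π² ≤ 1.621139` (outward decimal of the kinematic `t′`-Lipschitz constant). [cite: LiebLoss1993, §8, Theorem 8.2] -/
theorem sixteen_div_pi_sq_le_Krow_img : 16 / Real.pi ^ 2 ≤ (1621139/1000000 : ℝ) := by
  have hπ : (3.14159265358979323846 : ℝ) < Real.pi := Real.pi_gt_d20
  have hpos : (0 : ℝ) < Real.pi ^ 2 := by positivity
  have hsq : (9.869604401 : ℝ) < Real.pi ^ 2 := by nlinarith
  rw [div_le_iff₀ hpos]
  nlinarith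

/-- **Pointwise `t′`-edge floor.** A floor `X ≤ e(1, s, U, n)` at the column `t′ = s` (`U ≥ 0`, `0 ≤ n < 2`) gives, at any `t′ = s'`,
`X − 1.621139·|s' − s| ≤ e(1, s', U, n)` (kinematic transport of the next-nearest-neighbour hopping term,
`energyDensityTT'_sub_sixteen_div_pi_sq_mul_le`, with `16/π² ≤ 1.621139`). [cite: Israel1979, Thm. I.3.4] -/
theorem cell_point_edge_floor {s s' U n X : ℝ} (hU : 0 ≤ U) (hn0 : 0 ≤ n) (hn2 : n < 2)
    (hX : X ≤ energyDensityTT' 1 s U n) :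
    X - 1621139/1000000 * |s' - s| ≤ energyDensityTT' 1 s' U n := by
  have hk := energyDensityTT'_sub_sixteen_div_pi_sq_mul_le 1 hU hn0 hn2 s s'
  have h3 : 16 / Real.pi ^ 2 * |s' - s| ≤ 1621139/1000000 * |s' - s| :=
    mul_le_mul_of_nonneg_right sixteen_div_pi_sq_le_Krow_img (abs_nonneg _)
  linarith

end Summit.Ventures.CertifiedManyBodySolver.Certificates

end
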